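import Summits.NavierStokesRegularity.NavierStokesRegularity.Theorems.StrainDoorsCompositionsB
import Summits.NavierStokesRegularity.NavierStokesRegularity.Theorems.StrainDoorsGrowth
import Summits.NavierStokesRegularity.NavierStokesRegularity.Theorems.StrainDoorsDecay
import Summits.NavierStokesRegularity.NavierStokesRegularity.Theorems.StrainDoorsAlmostCompositions
import Summits.NavierStokesRegularity.NavierStokesRegularity.Theorems.StrainDoorsGrowthWeighted
import HarnessLib

/-!
# S37 «StrainDoors» — doors H «StrainFeedingDoor» and Π «PressureFocusingDoor» CLOSED BY NAME (EXACT family)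

Summits-side closers (theorems only) for door family S37 of the `NoTypeII` door programme (nsreg-p1 g31, ROUND-35
c653b89364d543f7; texts of record `r35/Sketch37.lean` 265cb074f1d98fd0 = tree P0-37 `…StrainDoorsDefs` /
`…StrainDoorsCompositions` / `…StrainDoorsCompositionsB`; LEAD ns-s30-p1 g3).  Door Λ `subcriticalStrainDoor_holds` is
closed in `…StrainDoorsCompositions`; here the remaining plates are discharged BY NAME and the doors composed:

* E1_S `strainGrowth_holds : StrainGrowth` := ns-sfl-p1 g5's `ArgmaxDoors.strainGrowth` (`…StrainDoorsGrowth`, p658468);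
* D_S `gradientUniformDecay_holds : GradientUniformDecay` := ns-sfl-p1 g5's `ArgmaxDoors.gradientUniformDecay`
  (`…StrainDoorsDecay`, p659680; pressure-free Biot–Savart route, a frame THEOREM);
* E2_S `strainThreshold_holds` := `strainThreshold_of` D_S E2_S-lin (`strainThresholdLinear_holds`, LEAD p657868);
* door H `strainFeedingDoor_holds : StrainFeedingDoor` := `strainFeedingDoor_of_plates` E1_S D_S E2_S-lin;
* door Π `pressureFocusingDoor_holds : PressureFocusingDoor` := `pressureFocusingDoor_of_plates` E1_S D_S E2_S-lin.

Seat ns-s29-p2 g4 on the LEAD's key 2026-08-28T18:39:13Z (a) / 19:03:39Z and ns-sfl-p1 g5's word 19:05:11Z.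

HONEST FRAME: THRESHOLD CRITERIA read at ONE POINT PER TIME (the argmax of the strain quotient `⟪∇u e, e⟫` of a
hypothetical blow-up: feeding `(T−t)²·strainFeed ≤ c` above the line `y₀/(T−t)` ⇒ continuation); UNCONDITIONAL (no
named-fact hypothesis); item 0056 `NoTypeII` and NS regularity are NOT proved by this;
`--supports stmt-NavierStokesRegularity-0056 --as helper`.
-/

noncomputable section

set_option linter.dupNamespace false

namespace Summit.NavierStokesRegularity.NavierStokesRegularity.Theorems.StrainDoors

open Summit.NavierStokesRegularity.NavierStokesRegularity.Theorems.ArgmaxDoors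

/-- plate E1_S «StrainGrowth» DISCHARGED BY NAME (ns-sfl-p1 g5, `ArgmaxDoors.strainGrowth`, p658468). [folklore] -/
theorem strainGrowth_holds : StrainGrowth := strainGrowth

/-- plate D_S «GradientUniformDecay» DISCHARGED BY NAME (ns-sfl-p1 g5, `ArgmaxDoors.gradientUniformDecay`, p659680: uniform
spatial decay of `∇u` on closed slabs of the frame, via Biot–Savart and `vorticity_uniform_decay`). [folklore] -/
theorem gradientUniformDecay_holds : GradientUniformDecay := gradientUniformDecay

/-- plate E2_S «StrainThreshold» CLOSED: `strainThreshold_of` D_S E2_S-lin. [folklore] -/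
theorem strainThreshold_holds : StrainThreshold :=
  strainThreshold_of gradientUniformDecay_holds strainThresholdLinear_holds

/-- **Door S37-H «StrainFeedingDoor» CLOSED BY NAME**: `strainFeedingDoor_of_plates` E1_S D_S E2_S-lin. [folklore] -/
theorem strainFeedingDoor_holds : StrainFeedingDoor :=
  strainFeedingDoor_of_plates strainGrowth_holds gradientUniformDecay_holds strainThresholdLinear_holds

/-- **Door S37-Π «PressureFocusingDoor» CLOSED BY NAME** (deviatoric pressure-Hessian form, through «PoissonTrace»):
`pressureFocusingDoor_of_plates` E1_S D_S E2_S-lin. [folklore] -/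
theorem pressureFocusingDoor_holds : PressureFocusingDoor :=
  pressureFocusingDoor_of_plates strainGrowth_holds gradientUniformDecay_holds strainThresholdLinear_holds

/-! ### The ALMOST-MAXIMISER twins H♭ / Π♭ (appended; LEAD's word 2026-08-28T19:28:05Z) -/

/-- plate E1_S♭ «StrainGrowthWeighted» DISCHARGED BY NAME (ns-sfl-p1 g5, `ArgmaxDoors.strainGrowthWeighted`,
`…StrainDoorsGrowthWeighted`, p660752). [folklore] -/
theorem strainGrowthWeighted_holds : StrainGrowthWeighted := strainGrowthWeighted

/-- **Door S37-H♭ «StrainFeedingDoorAlmost» CLOSED BY NAME** (charged at all `(1−δ)`-almost maximisers of the strain quotient;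
no decay plate): `strainFeedingDoorAlmost_of_plates` E1_S♭ (`…StrainDoorsAlmostCompositions`).  UNCONDITIONAL; 0056 `NoTypeII` /
NS regularity NOT proved. [folklore] -/
theorem strainFeedingDoorAlmost_holds : StrainFeedingDoorAlmost :=
  strainFeedingDoorAlmost_of_plates strainGrowthWeighted_holds

/-- **Door S37-Π♭ «PressureFocusingDoorAlmost» CLOSED BY NAME**: `pressureFocusingDoorAlmost_of_plates` E1_S♭.  UNCONDITIONAL;
0056 `NoTypeII` / NS regularity NOT proved. [folklore] -/
theorem pressureFocusingDoorAlmost_holds : PressureFocusingDoorAlmost :=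
  pressureFocusingDoorAlmost_of_plates strainGrowthWeighted_holds

end Summit.NavierStokesRegularity.NavierStokesRegularity.Theorems.StrainDoors

end
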